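import Literature.AlgebraicGeometry.Motives.HodgeLieOfAbelianVarietyBiproduct
import Literature.AlgebraicGeometry.Motives.HodgeLieCenterIsomorphismInvariance
import Literature.AlgebraicGeometry.Motives.HodgeLieDirectSumCenterBound
import HarnessLib

/-!
# `dim 𝔷(H¹(⨁_j A_j)) ≤ Σ_j dim 𝔷(H¹A_j)` and `dim [𝔥, 𝔥](H¹(⨁_j A_j)) ≤ Σ_j dim [𝔥, 𝔥](H¹A_j)`: the centre and the
# semisimple part of the Hodge Lie algebra of a product of complex abelian varieties are bounded by those of the factors

Family `hodge`, layer `Literature/AlgebraicGeometry/Motives`; THEOREMS ONLY (no definition, no named fact).  Written for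
the cell `pub-hodgecm2` (COR-CM), seat `b27` gen 43 (count-neutral Mumford–Tate-rank ladder).  For the Betti Hodge structure
`H = H¹(X(ℂ); ℚ)` of a complex abelian variety write `𝔥 = Lie Hg(H¹X) = H.hodgeLie`, `𝔷 = 𝔥 ∩ End_Hdg(H)` (its centre,
`hodgeLie_center_eq_inf_endAlg`) and `𝔡 = [𝔥, 𝔥] = span {XY − YX}` (its semisimple part).  The abstract statements
`dim 𝔷(⊕_j H_j) ≤ Σ_j dim 𝔷(H_j)`, `dim 𝔡(⊕_j H_j) ≤ Σ_j dim 𝔡(H_j)` of `Motives/HodgeLieDirectSumCenterBound` (the block map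
`Y ↦ (pr_j Y in_j)_j` is injective on `𝔥(⊕ H_j)`, multiplicative on it, and preserves `𝔥` and `End_Hdg`) are transported
along Künneth in degree one (`pi_hodge_one_eq_comapEquiv_biproduct`: `H¹(⨁_j A_j) ≅ ⊕_j H¹(A_j)`), using that `dim 𝔷` and
`dim 𝔡` are isomorphism invariants (`finrank_hodgeLie_inf_endAlg_comapEquiv`, `finrank_hodgeLie_derived_comapEquiv`), and
along isogenies (`hodge_one_eq_comapEquiv_of_isIsogeny`).  In Moonen–Zarhin's terms: the central torus (type-IV part) and
the semisimple part of `Hg(A_1 × ⋯ × A_r) ⊆ Hg(A_1) × ⋯ × Hg(A_r)` project injectively to the products of those of the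
factors; in particular a product of varieties with `𝔷 = 0` (no factor of type IV) has `𝔷 = 0`, and the semisimple rank
of a product is at most the sum over the factors.  These refine gen 35's `finrank_hodgeLie_hodge_one_biproduct_le_sum`
(`dim 𝔥 ≤ Σ dim 𝔥`) summand by summand (`dim 𝔥 = dim 𝔷 + dim 𝔡`, `AnyWeight.finrank_hodgeLie_eq_center_add_derived`).

* **`finrank_hodgeLie_inf_endAlg_hodge_one_biproduct_le_sum`**, **`finrank_hodgeLie_derived_hodge_one_biproduct_le_sum`** —
  for `⨁_j A_j` itself;
* **`finrank_hodgeLie_inf_endAlg_hodge_one_le_sum_of_isIsogenous_biproduct`**,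
  **`finrank_hodgeLie_derived_hodge_one_le_sum_of_isIsogenous_biproduct`** — for every `X ∼ ⨁_j A_j`.

(The isogeny invariance of `dim 𝔷(H¹X)` and `dim 𝔡(H¹X)` is public in `Motives/HodgeLieCenterOfAbelianVarietyProducts`;
the three-line argument is repeated privately here so that this file depends only on built modules of the centre story.)

## References
* [MoonenZarhin1999LowDim] B. Moonen, Yu. Zarhin, *Hodge classes on abelian varieties of low dimension*, Math. Ann. 315
  (1999), §1 and §3 (`Hg(X₁ × X₂) ⊆ Hg(X₁) × Hg(X₂)`, type-IV part = centre) [corpus: paper:arxiv-math_9901113 pp. 2, 6].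
* [Deligne1982HodgeCycles] P. Deligne, *Hodge cycles on abelian varieties*, LNM 900 (1982), I §3.1, Prop. 3.4, Prop. 3.6.
* [VoisinHodgeI2002] C. Voisin, *Hodge Theory and Complex Algebraic Geometry I*, §7.3.2 and Thm. 11.38 (Künneth).
-/

noncomputable section

open CategoryTheory CategoryTheory.Limits

namespace Literature.AlgebraicGeometry.Motives

namespace AbelianVariety

open Literature.AlgebraicGeometry.HodgeTheory
open Literature.AlgebraicGeometry.Motives.HodgeStructure
open Literature.AlgebraicGeometry.Pohlmann1968 (hodge_one_eq_comapEquiv_of_isIsogeny)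

variable [HodgeTensorFacts.{0, 0}]

/-! ### §1 Isogeny (private transport) -/

section Isogeny

variable {X X' : AbelianVariety ℂ} {n m : ℕ} (hX : IsSmoothProjective n X.X) (hX' : IsSmoothProjective m X'.X)

include hX hX' in
/-- `dim 𝔷(H¹X) = dim 𝔷(H¹X')` for `X ∼ X'` (private copy; public in `Motives/HodgeLieCenterOfAbelianVarietyProducts`).
[cite: MoonenZarhin1999LowDim, §1] [cite: VoisinHodgeI2002, §7.3.2] -/
private theorem finrank_center_hodge_one_eq_of_isIsogenous (h : IsIsogenous X X') :
    haveI := BettiUniverse.finite hX 1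
    haveI := BettiUniverse.finite hX' 1
    Module.finrank ℚ ↥((BettiUniverse.hodge exists_isReal_hodgeModel_holds hX 1).hodgeLie ⊓
        Subalgebra.toSubmodule (BettiUniverse.hodge exists_isReal_hodgeModel_holds hX 1).endAlg) =
      Module.finrank ℚ ↥((BettiUniverse.hodge exists_isReal_hodgeModel_holds hX' 1).hodgeLie ⊓
        Subalgebra.toSubmodule (BettiUniverse.hodge exists_isReal_hodgeModel_holds hX' 1).endAlg) := by
  haveI := BettiUniverse.finite hX 1
  haveI := BettiUniverse.finite hX' 1
  obtain ⟨g, hg⟩ := h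
  rw [hodge_one_eq_comapEquiv_of_isIsogeny hX hX' hg]
  exact (finrank_hodgeLie_inf_endAlg_comapEquiv _ _).symm

include hX hX' in
/-- `dim 𝔡(H¹X) = dim 𝔡(H¹X')` for `X ∼ X'` (private copy; public in `Motives/HodgeLieCenterOfAbelianVarietyProducts`).
[cite: MoonenZarhin1999LowDim, §1] [cite: VoisinHodgeI2002, §7.3.2] -/
private theorem finrank_derived_hodge_one_eq_of_isIsogenous (h : IsIsogenous X X') :
    haveI := BettiUniverse.finite hX 1
    haveI := BettiUniverse.finite hX' 1
    Module.finrank ℚ ↥(Submodule.span ℚ {B | ∃ A ∈ (BettiUniverse.hodge exists_isReal_hodgeModel_holds hX 1).hodgeLie,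
        ∃ C ∈ (BettiUniverse.hodge exists_isReal_hodgeModel_holds hX 1).hodgeLie, A * C - C * A = B}) =
      Module.finrank ℚ ↥(Submodule.span ℚ {B | ∃ A ∈ (BettiUniverse.hodge exists_isReal_hodgeModel_holds hX' 1).hodgeLie,
        ∃ C ∈ (BettiUniverse.hodge exists_isReal_hodgeModel_holds hX' 1).hodgeLie, A * C - C * A = B}) := by
  haveI := BettiUniverse.finite hX 1
  haveI := BettiUniverse.finite hX' 1
  obtain ⟨g, hg⟩ := h
  rw [hodge_one_eq_comapEquiv_of_isIsogeny hX hX' hg]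
  exact (finrank_hodgeLie_derived_comapEquiv _ _).symm

end Isogeny

/-! ### §2 Biproducts -/

section Biproduct

variable {J : Type} [Fintype J] [DecidableEq J] {A : J → AbelianVariety ℂ} {d : J → ℕ} {m : ℕ}
  (hA : ∀ j, IsSmoothProjective (d j) (A j).X) (hB : IsSmoothProjective m (⨁ A).X)

/-- **`dim 𝔷(H¹(⨁_j A_j)) ≤ Σ_j dim 𝔷(H¹A_j)`** (`𝔷 = Lie Hg ∩ End_Hdg`, the centre of the Hodge Lie algebra): Künneth in
degree one, `dim 𝔷(e^* H) = dim 𝔷(H)`, and `HodgeStructure.finrank_hodgeLie_inf_endAlg_pi_le_sum`.  The central torus of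
`Hg(∏ A_j)` is no bigger than the product of those of the factors. [cite: MoonenZarhin1999LowDim, §1 and §3]
[cite: Deligne1982HodgeCycles, I §3 Prop. 3.6] [cite: VoisinHodgeI2002, §7.3.2] -/
theorem finrank_hodgeLie_inf_endAlg_hodge_one_biproduct_le_sum :
    haveI := BettiUniverse.finite hB 1
    haveI : ∀ j, Module.Finite ℚ (bettiCohomology (A j).X 1) := fun j => BettiUniverse.finite (hA j) 1
    Module.finrank ℚ ↥((BettiUniverse.hodge exists_isReal_hodgeModel_holds hB 1).hodgeLie ⊓
        Subalgebra.toSubmodule (BettiUniverse.hodge exists_isReal_hodgeModel_holds hB 1).endAlg) ≤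
      ∑ j, Module.finrank ℚ ↥((BettiUniverse.hodge exists_isReal_hodgeModel_holds (hA j) 1).hodgeLie ⊓
        Subalgebra.toSubmodule (BettiUniverse.hodge exists_isReal_hodgeModel_holds (hA j) 1).endAlg) := by
  haveI := BettiUniverse.finite hB 1
  haveI : ∀ j, Module.Finite ℚ (bettiCohomology (A j).X 1) := fun j => BettiUniverse.finite (hA j) 1
  have hpi := pi_hodge_one_eq_comapEquiv_biproduct hA hB exists_isReal_hodgeModel_holds hodgePQ_independent_of_hodgeModel_holds
  have heq := finrank_hodgeLie_inf_endAlg_comapEquiv (BettiUniverse.hodge exists_isReal_hodgeModel_holds hB 1)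
    (LinearEquiv.ofBijective
      (∑ j, BettiUniverse.pull (biproduct.π A j).hom.hom.hom 1 ∘ₗ LinearMap.proj j :
        (∀ j, bettiCohomology (A j).X 1) →ₗ[ℚ] bettiCohomology (⨁ A).X 1)
      (bijective_sum_pull_biproduct_π A))
  rw [← hpi] at heq
  rw [← heq]
  exact finrank_hodgeLie_inf_endAlg_pi_le_sum _

/-- **`dim [𝔥, 𝔥](H¹(⨁_j A_j)) ≤ Σ_j dim [𝔥, 𝔥](H¹A_j)`** (the semisimple part of the Hodge Lie algebra): Künneth in degree
one, `dim 𝔡(e^* H) = dim 𝔡(H)`, and `HodgeStructure.finrank_hodgeLie_derived_pi_le_sum`. [cite: MoonenZarhin1999LowDim, §1 and §3]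
[cite: Deligne1982HodgeCycles, I §3 Prop. 3.6] [cite: VoisinHodgeI2002, §7.3.2] -/
theorem finrank_hodgeLie_derived_hodge_one_biproduct_le_sum :
    haveI := BettiUniverse.finite hB 1
    haveI : ∀ j, Module.Finite ℚ (bettiCohomology (A j).X 1) := fun j => BettiUniverse.finite (hA j) 1
    Module.finrank ℚ ↥(Submodule.span ℚ {B | ∃ Y ∈ (BettiUniverse.hodge exists_isReal_hodgeModel_holds hB 1).hodgeLie,
        ∃ C ∈ (BettiUniverse.hodge exists_isReal_hodgeModel_holds hB 1).hodgeLie, Y * C - C * Y = B}) ≤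
      ∑ j, Module.finrank ℚ ↥(Submodule.span ℚ {B | ∃ Y ∈ (BettiUniverse.hodge exists_isReal_hodgeModel_holds (hA j) 1).hodgeLie,
        ∃ C ∈ (BettiUniverse.hodge exists_isReal_hodgeModel_holds (hA j) 1).hodgeLie, Y * C - C * Y = B}) := by
  haveI := BettiUniverse.finite hB 1
  haveI : ∀ j, Module.Finite ℚ (bettiCohomology (A j).X 1) := fun j => BettiUniverse.finite (hA j) 1
  have hpi := pi_hodge_one_eq_comapEquiv_biproduct hA hB exists_isReal_hodgeModel_holds hodgePQ_independent_of_hodgeModel_holds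
  have heq := finrank_hodgeLie_derived_comapEquiv (BettiUniverse.hodge exists_isReal_hodgeModel_holds hB 1)
    (LinearEquiv.ofBijective
      (∑ j, BettiUniverse.pull (biproduct.π A j).hom.hom.hom 1 ∘ₗ LinearMap.proj j :
        (∀ j, bettiCohomology (A j).X 1) →ₗ[ℚ] bettiCohomology (⨁ A).X 1)
      (bijective_sum_pull_biproduct_π A))
  rw [← hpi] at heq
  rw [← heq]
  exact finrank_hodgeLie_derived_pi_le_sum _

/-- **`dim 𝔷(H¹X) ≤ Σ_j dim 𝔷(H¹A_j)` for every `X ∼ ⨁_j A_j`.** [cite: MoonenZarhin1999LowDim, §1 and §3]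
[cite: Deligne1982HodgeCycles, I §3 Prop. 3.6] -/
theorem finrank_hodgeLie_inf_endAlg_hodge_one_le_sum_of_isIsogenous_biproduct {X : AbelianVariety ℂ} {n' : ℕ}
    (hX : IsSmoothProjective n' X.X) (h : IsIsogenous X (⨁ A)) :
    haveI := BettiUniverse.finite hX 1
    haveI : ∀ j, Module.Finite ℚ (bettiCohomology (A j).X 1) := fun j => BettiUniverse.finite (hA j) 1
    Module.finrank ℚ ↥((BettiUniverse.hodge exists_isReal_hodgeModel_holds hX 1).hodgeLie ⊓
        Subalgebra.toSubmodule (BettiUniverse.hodge exists_isReal_hodgeModel_holds hX 1).endAlg) ≤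
      ∑ j, Module.finrank ℚ ↥((BettiUniverse.hodge exists_isReal_hodgeModel_holds (hA j) 1).hodgeLie ⊓
        Subalgebra.toSubmodule (BettiUniverse.hodge exists_isReal_hodgeModel_holds (hA j) 1).endAlg) := by
  have hP : IsSmoothProjective (⨁ A).dim (⨁ A).X := AbelianVariety.isSmoothProjective_holds
  haveI := BettiUniverse.finite hX 1
  haveI := BettiUniverse.finite hP 1
  haveI : ∀ j, Module.Finite ℚ (bettiCohomology (A j).X 1) := fun j => BettiUniverse.finite (hA j) 1
  rw [finrank_center_hodge_one_eq_of_isIsogenous hX hP h]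
  exact finrank_hodgeLie_inf_endAlg_hodge_one_biproduct_le_sum hA hP

/-- **`dim [𝔥, 𝔥](H¹X) ≤ Σ_j dim [𝔥, 𝔥](H¹A_j)` for every `X ∼ ⨁_j A_j`.** [cite: MoonenZarhin1999LowDim, §1 and §3]
[cite: Deligne1982HodgeCycles, I §3 Prop. 3.6] -/
theorem finrank_hodgeLie_derived_hodge_one_le_sum_of_isIsogenous_biproduct {X : AbelianVariety ℂ} {n' : ℕ}
    (hX : IsSmoothProjective n' X.X) (h : IsIsogenous X (⨁ A)) :
    haveI := BettiUniverse.finite hX 1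
    haveI : ∀ j, Module.Finite ℚ (bettiCohomology (A j).X 1) := fun j => BettiUniverse.finite (hA j) 1
    Module.finrank ℚ ↥(Submodule.span ℚ {B | ∃ Y ∈ (BettiUniverse.hodge exists_isReal_hodgeModel_holds hX 1).hodgeLie,
        ∃ C ∈ (BettiUniverse.hodge exists_isReal_hodgeModel_holds hX 1).hodgeLie, Y * C - C * Y = B}) ≤
      ∑ j, Module.finrank ℚ ↥(Submodule.span ℚ {B | ∃ Y ∈ (BettiUniverse.hodge exists_isReal_hodgeModel_holds (hA j) 1).hodgeLie,
        ∃ C ∈ (BettiUniverse.hodge exists_isReal_hodgeModel_holds (hA j) 1).hodgeLie, Y * C - C * Y = B}) := by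
  have hP : IsSmoothProjective (⨁ A).dim (⨁ A).X := AbelianVariety.isSmoothProjective_holds
  haveI := BettiUniverse.finite hX 1
  haveI := BettiUniverse.finite hP 1
  haveI : ∀ j, Module.Finite ℚ (bettiCohomology (A j).X 1) := fun j => BettiUniverse.finite (hA j) 1
  rw [finrank_derived_hodge_one_eq_of_isIsogenous hX hP h]
  exact finrank_hodgeLie_derived_hodge_one_biproduct_le_sum hA hP

end Biproduct

end AbelianVariety

end Literature.AlgebraicGeometry.Motives

end
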